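import Mathlib
import Summits.Parity.BatemanHorn.Theses.PolynomialMobius
import Summits.Parity.BatemanHorn.Theorems.PolynomialMobiusPolyMobiusTailStubPairCorner

/-!
# Witness (F3 / BC5) for line `window-three-corner` of crux stmt-Parity-0870 `PolyMobiusTail`

The rung family `WindowLinearCorner k` (VERBATIM the definition in `Lines/window_three_corner.lean`) SPECIALISES
at `k = 2` to the landed floor `EtaFreeWindow.stub_pair_corner` (p146909,
`Theorems/PolynomialMobiusPolyMobiusTailStubPairCorner.lean`): take `σ = 1/6` and rewrite
`min(d₀, d₁) ≤ x^σ ↔ ∃ i : Fin 2, dᵢ ≤ x^σ`.  No `sorry`.  The rung of the line is `WindowLinearCorner 3`.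
witness_regime: k = 2 linear Bateman–Horn pairs (e.g. `(X, X+2)`); S known there: NO (the Hardy–Littlewood pair
asymptotic / twin primes is open) — the floor is a parity-free localisation theorem, outside S's proved regime
(S is known only for k = 1 linear = Dirichlet).
-/

open scoped BigOperators Topology
open Filter Finset Polynomial Asymptotics

namespace Summit.Parity.BatemanHorn.Cruxes.PolyMobiusTail.WindowThreeCornerSpecial

open Literature.NumberTheory.Sieve
open Summit.Parity.BatemanHorn.Theorems.PolyMobiusTail.EtaFreeWindow

/-- Rung family, verbatim `Lines/window_three_corner.lean` `WindowLinearCorner`. -/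
def WindowLinearCorner (k : ℕ) : Prop :=
  ∀ (f : Fin k → ℤ[X]), IsBatemanHornSystem f → (∀ i, (f i).natDegree ≤ 1) →
    ∃ σ : ℝ, 0 < σ ∧ ∃ c : ℝ, 0 < c ∧ ∀ θ η : ℝ, 0 < θ → θ ≤ c → 0 < η → η ≤ c →
      (fun x : ℕ => ∑ n ∈ Finset.Icc 1 x,
        ∑ d ∈ Fintype.piFinset (fun i => (((f i).eval (n : ℤ)).toNat).divisors),
          if ((x : ℝ) ^ (1 - η) < ∏ i, (d i : ℝ) ∧ ∏ i, (d i : ℝ) ≤ (x : ℝ) ^ (1 + θ)) ∧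
              (∃ i, (d i : ℝ) ≤ (x : ℝ) ^ σ) then
            ∏ i, ((ArithmeticFunction.moebius (d i) : ℝ) * Real.log (d i)) else 0)
        =o[atTop] fun x : ℕ => (x : ℝ)

/-- **The floor `k = 2` of the rung family is the landed `stub_pair_corner`** (σ = 1/6). -/
theorem windowLinearCorner_two : WindowLinearCorner 2 := by
  intro f hf hlin
  obtain ⟨c, hc, H⟩ := stub_pair_corner f hf hlin (1 / 6) (by norm_num) (by norm_num)
  refine ⟨1 / 6, by norm_num, c, hc, fun θ η hθ hθc hη hηc => ?_⟩
  refine (H θ η hθ hθc hη hηc).congr_left fun x => ?_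
  refine Finset.sum_congr rfl fun n _ => Finset.sum_congr rfl fun d _ => ?_
  simp only [Fin.exists_fin_two, Nat.cast_min, min_le_iff, and_assoc]

/-- F3 shape: `example : Rung <floor parameter>`. -/
example : WindowLinearCorner 2 := windowLinearCorner_two

end Summit.Parity.BatemanHorn.Cruxes.PolyMobiusTail.WindowThreeCornerSpecial
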